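import Literature.MathematicalPhysics.QuantumFieldTheory.Balaban1983to89.B10Eq18SigmaSU2Haar
import Literature.MathematicalPhysics.QuantumFieldTheory.Balaban1983to89.B10Eq17LocalTorus
import Literature.MathematicalPhysics.QuantumFieldTheory.Balaban1983to89.B14Eq124Jacobians
import Literature.MathematicalPhysics.QuantumFieldTheory.GaussianToolkit

/-!
# `Balaban1983to89.B10Eq18ChangeOfVariables` — T. Bałaban, *Ultraviolet stability of three-dimensional lattice pure
# gauge field theories*, Commun. Math. Phys. **102** (1985) 255–275 [Balaban1985UV3], p. 260 «Thus we have (18)»: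
# THE SUBSTITUTION `A′ = A − D̃(A)` that carries the `A′`-integral of (13) (after `dU′ = σ(A′)dA′`) to the
# `A`-integral of (18) with its Jacobian `det(I − (δ/δA)D̃(A))` — PROVED AT MEASURE LEVEL (theorems only)

statement-level skeleton of published theorems with citation tags; proofs where landed; nothing here is a claim
about the Yang–Mills mass gap

PDF held: `paper:balaban1985-cmp102-uv-stability-3d` (journal page = PDF page + 254); pp. 259–261 [PDF 5–7] re-read
by this seat on the held text layer (`p0006.txt` ll. 18–33, `p0007.txt` ll. 5–12; the displays were read on the x2
renders `pub-balaban/b2b-balaban-ref1/pages/1985-cmp102-uv-stability-3d/…-p005-x2.png`, `…-p006-x2.png` in this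
lineage's gens 8–17).

WHAT IS REPRODUCED.  Mega-formalization `lit-balaban` (HOME `run/shared/lean/pub/lit-balaban/`), unit `lit-balaban-r07`
gen 18 (B10 fold owner; TAKING line HOME/STATUS.md 2026-08-22T06:54Z, free-target protocol).  SKELETON rows of
`lit-balaban-r07/ROWS-B10.md`: the proof-narrative display **E18** (§2, (18) p. 260) — cells «chain inside `Bound55`
(k = 0) — covered» — and the cells of **B10.Eq17** / **B10.Eq20** / **B10.Eq21**; NO head change.  The sentence
formalised here is the passage from (13) to (18): print writes the `U′`-integral of (13) in the variables `A′`
(`dU′ = σ(A′)dA′`, p. 260 — the sibling `B10Eq18SigmaSU2Haar`, measure level for `SU(2)`) and then, silently («Thus we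
have»), in the variables `A` with `A′ = A − D̃(A)` ((17)): (18) carries the Jacobian `det(I − (δ/δA)D̃(A))`, the density
`(σ/σ₀)(A − D̃(A))` and `exp i(A − D̃(A))U₁`.  The tree had the ALGEBRA of this step — (20) `det(I − δD̃/δA) = Π_c det(1 −
J_c)` from the support/locality of `D̃` (`B10Eq20Locality`), (21)/(22) (`B10Eq22Rescaling`), the solution `D̃` of (17)
(`B10Eq17LocalSolution`/`B10Eq17LocalTorus`), the cut-off enlargement of (13) (`B10Eq13Enlargement`) — but not the
change of variables itself as an identity of integrals.  This file proves it, BY NAME from Mathlib's change-of-variables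
theorem for injective differentiable maps on a finite-dimensional real space
(`MeasureTheory.lintegral_image_eq_lintegral_abs_det_fderiv_mul`, `integral_image_eq_integral_abs_det_fderiv_smul`).

THE PRINTED TEXT (verbatim, text layer p0006/p0007).  p. 260: *"To write the integrals (13) in terms of the variables A′
we express the Haar measure dU′ as dU′ = σ(A′)dA′ = σ₀ (σ/σ₀)(A′)dA′, σ₀ = σ(0), where dA′ is the Lebesque measure on g,
and σ(A′) is a density which can be calculated explicitly for all classical groups. … Thus we have
(Tρ₀)(V) ≤ Σ_{Ω₁} χ₁ ∫dV₀↾_{Ω₁ᶜ} Π_{b′⊂Ω₁ᶜ} δ(V̄₀(b′)V⁻¹(b′)) ζ_{Ω₁ᶜ} ∫dA↾_{Ω₁} det(I − (δ/δA)D̃(A)) (σ/σ₀)(A − D̃(A))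
δ(QA) δ_{Ax}(A) χ exp[−(1/g₀²)A(exp i(A − D̃(A))U₁) − E + log σ₀|Ω₁*|],   (18)
where χ = Π_{b∈Ω₁} χ({|A(b)| < g₀p²(g₀)}), g₀ sufficiently small, and |Ω₁*| denotes the number of bonds belonging to Ω₁
minus the number of bonds in Ω₁⁽¹⁾ and minus the number of bonds in the axial gauge fixing set."*; p. 260 on `D̃`
((17)): *"There exists a unique solution D̃ of this equation for A sufficiently small, and it is an analytic function of
A with a Taylor expansion beginning with second order terms."*; p. 261: *"Let us exponentiate the determinant and the
function σ/σ₀ in (18). The determinant can be written as exp Tr log(I − (δ/δA)D̃(A)) = exp[Σ_{c∈Ω₁⁽¹⁾} tr log(1 −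
(∂/∂A(b₀(c)))D̃(A, b₀(c), c))],   (20)"*.

WHAT THIS FILE PROVES (kernel, 0 sorry, standard axioms; no definition, no new named fact; everything by name from
Mathlib and the sibling modules).
* §1 THE SUBSTITUTION on any finite-dimensional real normed space `E` with an additive Haar measure `μ` (= «the
  Lebesque measure dA»), for `D̃ : E → E` with derivative `(δ/δA)D̃(A) = L A` within a Borel region `S`:
  `hasFDerivWithinAt_id_sub` (the map `A ↦ A − D̃(A)` has derivative `I − L A`); INJECTIVITY of `A ↦ A − D̃(A)` from a
  strict contraction (`injOn_id_sub_of_lipschitzOnWith`) and from the derivative bound `‖L A‖ ≤ K < 1` on a convex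
  region (`injOn_id_sub_of_nnnorm_fderiv_le`, mean value inequality); THE SIGN OF THE JACOBIAN: `det(I − T) > 0` for
  `‖T‖ < 1` (`det_one_sub_pos`, by name from `B14Eq124Jacobians.det_pos_of_norm_sub_one_lt`; so print's `det` without
  absolute value is the volume factor, `abs_det_one_sub`); the change of variables in absolute-value form
  (`lintegral_image_id_sub`, `integral_image_id_sub`, `measure_image_id_sub`, `integrableOn_image_id_sub_iff`,
  `measurableSet_image_id_sub`) and WITH THE PRINTED JACOBIAN (`lintegral_image_id_sub_det`, `integral_image_id_sub_det`,
  `measure_image_id_sub_det`); packaged as **`eq18_substitution`**: on a convex Borel `S` with `‖(δ/δA)D̃(A)‖ ≤ K < 1`,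
  `∫_{(I − D̃)(S)} g(A′) dA′ = ∫_S det(I − (δ/δA)D̃(A)) g(A − D̃(A)) dA` for every `g ≥ 0` (Bochner form
  `eq18_substitution_integral`, volume form `eq18_substitution_measure`), and with print's INEQUALITY sign for a smaller
  `A′`-region `T ⊆ (I − D̃)(S)` (`eq18_substitution_le` — (13)/(18) are upper bounds; the `A`-window `χ` of (18) is an
  enlargement of the pull-back of the cut-off `χ′` of (13), as the enlargement in (13) itself, `B10Eq13Enlargement`).
* §2 IN B10's COORDINATES `A : β → ι → ℝ` (bonds `β`, a basis `ι` of 𝔤, Lebesgue measure): the Jacobian as the matrix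
  determinant `det(1 − jac L)` of `B10Eq20Locality` (`det_one_sub_eq_det_jac`, `eq18_substitution_coord`) and
  **(18) WITH (20) INSERTED** (`eq18_substitution_eq20`): under the printed support (S) and locality (Loc) of `D̃` the
  volume factor is `Π_c det(1 − (∂/∂A(b₀(c)))D̃(A, b₀(c), c))` (`B10Eq20Locality.eq20_det_jac` by name).
* §3 `G = SU(2)`, finitely many bonds: the product chart law `Π_b σ(A(b))dA(b)` of `B10Eq18SigmaSU2Haar` §8 is Lebesgue
  measure on the product window with density `Π_b σ_{SU(2)}(|A(b)|)` (`pi_sigmaMeasure_eq`, by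
  `GaussianToolkit.pi_withDensity`); `∫Π_b dU′(b) F = ∫_{|A(b)|<π} Π_b σ(|A(b)|) F((e^{iA(b)})_b) dA`
  (`lintegral_pi_haarProbability_eq_volume`); **THE INTEGRAND SHAPE OF (18)** (`eq18_su2`, `eq18_su2_le`):
  `∫_{(I−D̃)(S)} Π_bσ(|A′(b)|) F(e^{iA′}) dA′ = ∫_S det(I − (δ/δA)D̃(A)) Π_bσ(|(A − D̃(A))(b)|) F(e^{i(A − D̃(A))}) dA`;
  the `σ₀`-bookkeeping behind «+ log σ₀|Ω₁*|»: `Π_bσ = σ₀^{#bonds}·Π_b(σ/σ₀)` (`prod_sigmaSU2_eq_pow_mul_prod_ratio`),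
  `σ₀ⁿ = exp(n log σ₀)` (`sigmaSU2_zero_pow_eq_exp`) and `σ₀^{n₁}σ₀^{−n₂}σ₀^{−n₃} = exp[log σ₀ (n₁ − n₂ − n₃)]`
  (`sigmaSU2_zero_pow_starCount`; the subtractions = the `σ₀⁻¹` of each δ-function of (16),
  `B10Eq18SigmaSU2Haar.dirac_eq_inv_sigma0_smul`, for the bonds of Ω₁⁽¹⁾ and the axial bonds — located, not composed here).
* §4 FROM (17): for the local solution `D̃` of (17) typed by `B10Eq17LocalSolution.Eq17Local` (analytic on `|A| < r`,
  `D̃(0) = 0`, `(δ/δA)D̃(0) = 0`) and print's support operator `h` (`‖h_c x‖ ≤ b‖x‖`), there is a window `0 < r′ ≤ r`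
  with `‖(δ/δA)hD̃(A)‖ ≤ 1/2` on `|A| < r′` (`exists_window_nnnorm_fderiv_le` — «A sufficiently small», continuity at `0`
  of the derivative of an analytic map) and hence, on every convex Borel `S ⊆ {|A| < r′}`, injectivity, positivity of the
  Jacobian and the substitution identity for `A′ = A − hD̃(A)` (**`eq18_substitution_of_eq17Local`**).
HONEST SCOPE / DEVIATIONS.  (i) «δ/δA» = Fréchet derivative (within `S` in §1, at points in §§2, 4), `det` of (18) =
`LinearMap.det` of `I − (δ/δA)D̃(A)` (cell DIVERGENCE D-b10.15, as in `B10Eq20Locality`); the smallness «A sufficiently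
small» is made explicit as `‖(δ/δA)D̃(A)‖ ≤ K < 1` on a CONVEX window (print's windows `χ`, `χ′` are products of balls,
hence convex).  (ii) The δ-functions `δ(QA)`, `δ_{Ax}(A)`, the action and `E` of (18) are untouched: the theorems are
about the measure `dA′` versus `dA` and an arbitrary integrand `g ≥ 0` (resp. Banach-valued); the composition with the
surface measures of the δ-functions is the leaf's business (`B10SectAStatements`, `Bound55`).  (iii) §3 is `SU(2)` in
the Pauli coordinates of `B10Eq18SigmaSU2Haar` (configurations `β → ℝ³`); for general compact `G` the one-bond law
`dU′ = σ(A′)dA′` is p24/p28's `HaarExpChartLocal`/`HaarLocalChart` programme, and §1 applies verbatim to it.  (iv) §4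
produces SOME window `r′` by continuity; print's quantitative window (`|A(b)| < g₀p²(g₀)`) needs the second-order
Taylor bound of `D̃` ([7] (55)), not typed here.  (v) `B14Eq124Jacobians` ([Balaban1988Convergent] (1.24)) is imported
only for the generic lemma `det_pos_of_norm_sub_one_lt`; `GaussianToolkit` only for the generic `pi_withDensity`.
NOT summit progress.
-/

noncomputable section

open MeasureTheory MeasureTheory.Measure Set Metric
open scoped ENNReal NNReal ContDiff

namespace Literature.MathematicalPhysics.QuantumFieldTheory.Balaban1983to89.B10Eq18ChangeOfVariables

/-! ## §1  The substitution `A′ = A − D̃(A)`: injectivity, the sign of the Jacobian, and the change of variables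
(any finite-dimensional real normed space `E`, any additive Haar measure `μ` = «the Lebesque measure dA») -/

section Algebra

variable {E : Type*} [NormedAddCommGroup E] [NormedSpace ℝ E] {𝒟 : E → E} {L : E → E →L[ℝ] E} {S : Set E}

/-- The substitution map `A ↦ A′ = A − D̃(A)` has derivative `I − (δ/δA)D̃(A)` wherever `D̃` has derivative
`(δ/δA)D̃(A)` (within the region `S`). [cite: Balaban1985UV3, (18) p.260] -/
theorem hasFDerivWithinAt_id_sub (h𝒟 : ∀ A ∈ S, HasFDerivWithinAt 𝒟 (L A) S A) {A : E} (hA : A ∈ S) :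
    HasFDerivWithinAt (fun A => A - 𝒟 A) ((1 : E →L[ℝ] E) - L A) S A :=
  (hasFDerivWithinAt_id A S).sub (h𝒟 A hA)

omit [NormedSpace ℝ E] in
/-- **Injectivity of `A ↦ A − D̃(A)`** on a region where `D̃` is a strict contraction (`K`-Lipschitz, `K < 1`):
`A − D̃(A) = B − D̃(B)` forces `|A − B| = |D̃(A) − D̃(B)| ≤ K|A − B|`, so `A = B` — the injectivity half of «for A
sufficiently small» behind the substitution of (18). [cite: Balaban1985UV3, (17)-(18) p.260] -/
theorem injOn_id_sub_of_lipschitzOnWith {K : ℝ≥0} (h𝒟 : LipschitzOnWith K 𝒟 S) (hK : K < 1) :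
    InjOn (fun A => A - 𝒟 A) S := by
  intro A hA B hB hAB
  have hAB' : A - B = 𝒟 A - 𝒟 B := by
    have h : A - 𝒟 A = B - 𝒟 B := hAB
    rwa [sub_eq_sub_iff_sub_eq_sub] at h
  have h1 : ‖A - B‖ ≤ K * ‖A - B‖ := by
    calc ‖A - B‖ = ‖𝒟 A - 𝒟 B‖ := by rw [hAB']
      _ ≤ K * ‖A - B‖ := h𝒟.norm_sub_le hA hB
  have hK' : (K : ℝ) < 1 := by exact_mod_cast hK
  have h2 : ‖A - B‖ ≤ 0 := by nlinarith [norm_nonneg (A - B)]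
  exact sub_eq_zero.1 (norm_le_zero_iff.1 h2)

/-- **Injectivity from the derivative bound**: on a CONVEX region where `‖(δ/δA)D̃(A)‖ ≤ K < 1`, `D̃` is `K`-Lipschitz
(mean value inequality, Mathlib `Convex.lipschitzOnWith_of_nnnorm_hasFDerivWithin_le`), hence `A ↦ A − D̃(A)` is
injective — print's «for A sufficiently small» (D̃ is analytic with a Taylor expansion beginning with second order
terms, p. 260, so its derivative is small near `0`). [cite: Balaban1985UV3, (17)-(18) p.260] -/
theorem injOn_id_sub_of_nnnorm_fderiv_le (hconv : Convex ℝ S) (h𝒟 : ∀ A ∈ S, HasFDerivWithinAt 𝒟 (L A) S A)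
    {K : ℝ≥0} (hL : ∀ A ∈ S, ‖L A‖₊ ≤ K) (hK : K < 1) : InjOn (fun A => A - 𝒟 A) S :=
  injOn_id_sub_of_lipschitzOnWith (hconv.lipschitzOnWith_of_nnnorm_hasFDerivWithin_le h𝒟 hL) hK

/-- `‖T‖₊ ≤ K < 1 ⇒ ‖T‖ < 1` (bookkeeping between the two forms of the smallness hypothesis). [folklore] -/
private theorem norm_lt_one_of_nnnorm_le {T : E →L[ℝ] E} {K : ℝ≥0} (hT : ‖T‖₊ ≤ K) (hK : K < 1) : ‖T‖ < 1 := by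
  have h : (‖T‖₊ : ℝ) ≤ K := NNReal.coe_le_coe.2 hT
  rw [coe_nnnorm] at h
  exact h.trans_lt (by exact_mod_cast hK)

variable [FiniteDimensional ℝ E]

/-- **THE JACOBIAN OF (18) IS POSITIVE**: `det(I − T) > 0` for `‖T‖ < 1` on a finite-dimensional real space — so the
printed `det(I − (δ/δA)D̃(A))` (no absolute value) IS the volume factor of the change of variables.  By name from
`B14Eq124Jacobians.det_pos_of_norm_sub_one_lt` (Neumann series + connectedness). [cite: Balaban1985UV3, (18) p.260] -/
theorem det_one_sub_pos {T : E →L[ℝ] E} (hT : ‖T‖ < 1) : 0 < ((1 : E →L[ℝ] E) - T).det :=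
  B14Eq124Jacobians.det_pos_of_norm_sub_one_lt (by rwa [sub_sub_cancel_left, norm_neg])

/-- Hence `|det(I − T)| = det(I − T)` for `‖T‖ < 1`. [cite: Balaban1985UV3, (18) p.260] -/
theorem abs_det_one_sub {T : E →L[ℝ] E} (hT : ‖T‖ < 1) :
    |((1 : E →L[ℝ] E) - T).det| = ((1 : E →L[ℝ] E) - T).det :=
  abs_of_pos (det_one_sub_pos hT)

end Algebra

section General

variable {E : Type*} [NormedAddCommGroup E] [NormedSpace ℝ E] [FiniteDimensional ℝ E]
  [MeasurableSpace E] [BorelSpace E] (μ : Measure E) [IsAddHaarMeasure μ]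
  {𝒟 : E → E} {L : E → E →L[ℝ] E} {S : Set E}

omit [IsAddHaarMeasure μ] in
/-- The image region `{A − D̃(A) : A ∈ S}` (the region of the variables `A′`) is Borel, for `S` Borel, `D̃` differentiable
on `S` and `A ↦ A − D̃(A)` injective on `S` (Lusin–Souslin, Mathlib `measurable_image_of_fderivWithin`) — the region of
integration `∫dA′↾_{Ω₁}` of (13) written through (18)'s variables. [cite: Balaban1985UV3, (13)+(18) pp.259-260] -/
theorem measurableSet_image_id_sub (hS : MeasurableSet S) (h𝒟 : ∀ A ∈ S, HasFDerivWithinAt 𝒟 (L A) S A)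
    (hinj : InjOn (fun A => A - 𝒟 A) S) : MeasurableSet ((fun A => A - 𝒟 A) '' S) :=
  measurable_image_of_fderivWithin hS (fun _ hA => hasFDerivWithinAt_id_sub h𝒟 hA) hinj

/-- Volume of the image region: `dA′({A − D̃(A) : A ∈ S}) = ∫_S |det(I − (δ/δA)D̃(A))| dA` (the substitution of (18)
applied to `g ≡ 1`). [cite: Balaban1985UV3, (13)+(18) pp.259-260] -/
theorem measure_image_id_sub (hS : MeasurableSet S) (h𝒟 : ∀ A ∈ S, HasFDerivWithinAt 𝒟 (L A) S A)
    (hinj : InjOn (fun A => A - 𝒟 A) S) :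
    μ ((fun A => A - 𝒟 A) '' S) = ∫⁻ A in S, ENNReal.ofReal |((1 : E →L[ℝ] E) - L A).det| ∂μ :=
  (lintegral_abs_det_fderiv_eq_addHaar_image μ hS (fun _ hA => hasFDerivWithinAt_id_sub h𝒟 hA) hinj).symm

/-- **CHANGE OF VARIABLES `A′ = A − D̃(A)`, `ℝ≥0∞`-valued integrands, absolute-value form**:
`∫_{A′ ∈ (I − D̃)(S)} g(A′) dA′ = ∫_{A ∈ S} |det(I − (δ/δA)D̃(A))| g(A − D̃(A)) dA` — Mathlib's
`lintegral_image_eq_lintegral_abs_det_fderiv_mul` for the map `A ↦ A − D̃(A)`. [cite: Balaban1985UV3, (13)+(18) pp.259-260] -/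
theorem lintegral_image_id_sub (hS : MeasurableSet S) (h𝒟 : ∀ A ∈ S, HasFDerivWithinAt 𝒟 (L A) S A)
    (hinj : InjOn (fun A => A - 𝒟 A) S) (g : E → ℝ≥0∞) :
    ∫⁻ A' in (fun A => A - 𝒟 A) '' S, g A' ∂μ =
      ∫⁻ A in S, ENNReal.ofReal |((1 : E →L[ℝ] E) - L A).det| * g (A - 𝒟 A) ∂μ :=
  lintegral_image_eq_lintegral_abs_det_fderiv_mul μ hS (fun _ hA => hasFDerivWithinAt_id_sub h𝒟 hA) hinj g

/-- The same for Bochner integrals (`g` with values in a real Banach space; both sides `0` when not integrable).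
[cite: Balaban1985UV3, (13)+(18) pp.259-260] -/
theorem integral_image_id_sub {F : Type*} [NormedAddCommGroup F] [NormedSpace ℝ F] (hS : MeasurableSet S)
    (h𝒟 : ∀ A ∈ S, HasFDerivWithinAt 𝒟 (L A) S A) (hinj : InjOn (fun A => A - 𝒟 A) S) (g : E → F) :
    ∫ A' in (fun A => A - 𝒟 A) '' S, g A' ∂μ = ∫ A in S, |((1 : E →L[ℝ] E) - L A).det| • g (A - 𝒟 A) ∂μ :=
  integral_image_eq_integral_abs_det_fderiv_smul μ hS (fun _ hA => hasFDerivWithinAt_id_sub h𝒟 hA) hinj g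

/-- Integrability transfers along the substitution: `g` is integrable on the `A′`-region iff
`|det(I − (δ/δA)D̃(A))| g(A − D̃(A))` is integrable on `S` (the substitution of (18) at the level of integrability).
[cite: Balaban1985UV3, (13)+(18) pp.259-260] -/
theorem integrableOn_image_id_sub_iff {F : Type*} [NormedAddCommGroup F] [NormedSpace ℝ F] (hS : MeasurableSet S)
    (h𝒟 : ∀ A ∈ S, HasFDerivWithinAt 𝒟 (L A) S A) (hinj : InjOn (fun A => A - 𝒟 A) S) (g : E → F) :
    IntegrableOn g ((fun A => A - 𝒟 A) '' S) μ ↔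
      IntegrableOn (fun A => |((1 : E →L[ℝ] E) - L A).det| • g (A - 𝒟 A)) S μ :=
  integrableOn_image_iff_integrableOn_abs_det_fderiv_smul μ hS (fun _ hA => hasFDerivWithinAt_id_sub h𝒟 hA) hinj g

/-- **CHANGE OF VARIABLES WITH THE PRINTED JACOBIAN** (no absolute value): if moreover `‖(δ/δA)D̃(A)‖ < 1` on `S`, then
`∫_{(I − D̃)(S)} g(A′) dA′ = ∫_S det(I − (δ/δA)D̃(A)) g(A − D̃(A)) dA`. [cite: Balaban1985UV3, (18) p.260] -/
theorem lintegral_image_id_sub_det (hS : MeasurableSet S) (h𝒟 : ∀ A ∈ S, HasFDerivWithinAt 𝒟 (L A) S A)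
    (hinj : InjOn (fun A => A - 𝒟 A) S) (hL : ∀ A ∈ S, ‖L A‖ < 1) (g : E → ℝ≥0∞) :
    ∫⁻ A' in (fun A => A - 𝒟 A) '' S, g A' ∂μ =
      ∫⁻ A in S, ENNReal.ofReal ((1 : E →L[ℝ] E) - L A).det * g (A - 𝒟 A) ∂μ := by
  rw [lintegral_image_id_sub μ hS h𝒟 hinj g]
  refine setLIntegral_congr_fun hS (fun A hA => ?_)
  rw [abs_det_one_sub (hL A hA)]

/-- Bochner form of the previous theorem. [cite: Balaban1985UV3, (18) p.260] -/
theorem integral_image_id_sub_det {F : Type*} [NormedAddCommGroup F] [NormedSpace ℝ F] (hS : MeasurableSet S)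
    (h𝒟 : ∀ A ∈ S, HasFDerivWithinAt 𝒟 (L A) S A) (hinj : InjOn (fun A => A - 𝒟 A) S)
    (hL : ∀ A ∈ S, ‖L A‖ < 1) (g : E → F) :
    ∫ A' in (fun A => A - 𝒟 A) '' S, g A' ∂μ = ∫ A in S, ((1 : E →L[ℝ] E) - L A).det • g (A - 𝒟 A) ∂μ := by
  rw [integral_image_id_sub μ hS h𝒟 hinj g]
  refine setIntegral_congr_fun hS (fun A hA => ?_)
  simp only [abs_det_one_sub (hL A hA)]

/-- Volume form: `dA′((I − D̃)(S)) = ∫_S det(I − (δ/δA)D̃(A)) dA`. [cite: Balaban1985UV3, (18) p.260] -/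
theorem measure_image_id_sub_det (hS : MeasurableSet S) (h𝒟 : ∀ A ∈ S, HasFDerivWithinAt 𝒟 (L A) S A)
    (hinj : InjOn (fun A => A - 𝒟 A) S) (hL : ∀ A ∈ S, ‖L A‖ < 1) :
    μ ((fun A => A - 𝒟 A) '' S) = ∫⁻ A in S, ENNReal.ofReal ((1 : E →L[ℝ] E) - L A).det ∂μ := by
  rw [measure_image_id_sub μ hS h𝒟 hinj]
  refine setLIntegral_congr_fun hS (fun A hA => ?_)
  rw [abs_det_one_sub (hL A hA)]

/-- **«Thus we have (18)» — THE SUBSTITUTION `A′ = A − D̃(A)` AS PRINTED.**  On a convex Borel region `S` of the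
variables `A` on which `D̃` is differentiable with `‖(δ/δA)D̃(A)‖ ≤ K < 1` («A sufficiently small»): the map
`A ↦ A′ = A − D̃(A)` is injective on `S`, its Jacobian `det(I − (δ/δA)D̃(A))` is positive, and for every integrand
`g ≥ 0` of the variables `A′`,
`∫_{A′ ∈ (I − D̃)(S)} g(A′) dA′ = ∫_{A ∈ S} det(I − (δ/δA)D̃(A)) · g(A − D̃(A)) dA`
— the step carrying the `A′`-integral of (13) (after `dU′ = σ(A′)dA′`) to the `A`-integral of (18) with its factor
`det(I − (δ/δA)D̃(A))` and every occurrence of `A′` replaced by `A − D̃(A)` (`(σ/σ₀)(A − D̃(A))`,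
`exp i(A − D̃(A))U₁`, …). [cite: Balaban1985UV3, (18) p.260] -/
theorem eq18_substitution (hS : MeasurableSet S) (hconv : Convex ℝ S)
    (h𝒟 : ∀ A ∈ S, HasFDerivWithinAt 𝒟 (L A) S A) {K : ℝ≥0} (hL : ∀ A ∈ S, ‖L A‖₊ ≤ K) (hK : K < 1)
    (g : E → ℝ≥0∞) :
    ∫⁻ A' in (fun A => A - 𝒟 A) '' S, g A' ∂μ =
      ∫⁻ A in S, ENNReal.ofReal ((1 : E →L[ℝ] E) - L A).det * g (A - 𝒟 A) ∂μ :=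
  lintegral_image_id_sub_det μ hS h𝒟 (injOn_id_sub_of_nnnorm_fderiv_le hconv h𝒟 hL hK)
    (fun A hA => norm_lt_one_of_nnnorm_le (hL A hA) hK) g

/-- (18), Bochner form (real- or Banach-valued integrands, e.g. after the analytic continuation of Sect. A).
[cite: Balaban1985UV3, (18) p.260] -/
theorem eq18_substitution_integral {F : Type*} [NormedAddCommGroup F] [NormedSpace ℝ F] (hS : MeasurableSet S)
    (hconv : Convex ℝ S) (h𝒟 : ∀ A ∈ S, HasFDerivWithinAt 𝒟 (L A) S A) {K : ℝ≥0} (hL : ∀ A ∈ S, ‖L A‖₊ ≤ K)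
    (hK : K < 1) (g : E → F) :
    ∫ A' in (fun A => A - 𝒟 A) '' S, g A' ∂μ = ∫ A in S, ((1 : E →L[ℝ] E) - L A).det • g (A - 𝒟 A) ∂μ :=
  integral_image_id_sub_det μ hS h𝒟 (injOn_id_sub_of_nnnorm_fderiv_le hconv h𝒟 hL hK)
    (fun A hA => norm_lt_one_of_nnnorm_le (hL A hA) hK) g

/-- (18), volume form: `dA′((I − D̃)(S)) = ∫_S det(I − (δ/δA)D̃(A)) dA`. [cite: Balaban1985UV3, (18) p.260] -/
theorem eq18_substitution_measure (hS : MeasurableSet S) (hconv : Convex ℝ S)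
    (h𝒟 : ∀ A ∈ S, HasFDerivWithinAt 𝒟 (L A) S A) {K : ℝ≥0} (hL : ∀ A ∈ S, ‖L A‖₊ ≤ K) (hK : K < 1) :
    μ ((fun A => A - 𝒟 A) '' S) = ∫⁻ A in S, ENNReal.ofReal ((1 : E →L[ℝ] E) - L A).det ∂μ :=
  measure_image_id_sub_det μ hS h𝒟 (injOn_id_sub_of_nnnorm_fderiv_le hconv h𝒟 hL hK)
    (fun A hA => norm_lt_one_of_nnnorm_le (hL A hA) hK)

/-- (18) WITH THE PRINTED INEQUALITY SIGN: for any smaller `A′`-region `T ⊆ (I − D̃)(S)` (print integrates `A′` over the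
cut-off `χ′` of (13) and `A` over the larger window `χ = Π_b χ({|A(b)| < g₀p²(g₀)})` of (18) — an enlargement, as in
(13) itself) and `g ≥ 0`: `∫_T g(A′) dA′ ≤ ∫_S det(I − (δ/δA)D̃(A)) g(A − D̃(A)) dA`.
[cite: Balaban1985UV3, (13) p.259, (18) p.260] -/
theorem eq18_substitution_le (hS : MeasurableSet S) (hconv : Convex ℝ S)
    (h𝒟 : ∀ A ∈ S, HasFDerivWithinAt 𝒟 (L A) S A) {K : ℝ≥0} (hL : ∀ A ∈ S, ‖L A‖₊ ≤ K) (hK : K < 1)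
    {T : Set E} (hT : T ⊆ (fun A => A - 𝒟 A) '' S) (g : E → ℝ≥0∞) :
    ∫⁻ A' in T, g A' ∂μ ≤ ∫⁻ A in S, ENNReal.ofReal ((1 : E →L[ℝ] E) - L A).det * g (A - 𝒟 A) ∂μ := by
  rw [← eq18_substitution μ hS hconv h𝒟 hL hK g]
  exact lintegral_mono_set hT

end General

/-! ## §2  In B10's coordinates `A : β → ι → ℝ` (bonds `β`, a basis `ι` of 𝔤): the Jacobian of (18) as
`det(1 − jac L)` and, under the support/locality of `D̃`, as the block product (20) -/

section Coordinates

open B10Eq20Locality (jac coarseBlock IsSupportedOn IsCoarseLocal)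

variable {β ι : Type*} [Fintype β] [Fintype ι] [DecidableEq β] [DecidableEq ι]

/-- The operator determinant of (18) in coordinates: `det(I − L) = det(1 − jac L)` with `jac` the Jacobian matrix of
`B10Eq20Locality` (by name: `det_id_sub_eq`). [cite: Balaban1985UV3, (18) p.260] -/
theorem det_one_sub_eq_det_jac (L : (β → ι → ℝ) →L[ℝ] (β → ι → ℝ)) :
    ((1 : (β → ι → ℝ) →L[ℝ] (β → ι → ℝ)) - L).det
      = (1 - jac (L : (β → ι → ℝ) →ₗ[ℝ] (β → ι → ℝ))).det := by
  have h : (((1 : (β → ι → ℝ) →L[ℝ] (β → ι → ℝ)) - L : (β → ι → ℝ) →L[ℝ] (β → ι → ℝ)) :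
      (β → ι → ℝ) →ₗ[ℝ] (β → ι → ℝ)) = LinearMap.id - (L : (β → ι → ℝ) →ₗ[ℝ] (β → ι → ℝ)) := rfl
  rw [ContinuousLinearMap.det, h, B10Eq20Locality.det_id_sub_eq]

/-- **(18) in coordinates**: the substitution `A′ = A − D̃(A)` on configurations `A : β → ι → ℝ` (Lebesgue measure
`dA = Π_{b,i} dA(b)_i`), Jacobian written as the matrix determinant `det(1 − (δD̃/δA))`.
[cite: Balaban1985UV3, (18) p.260] -/
theorem eq18_substitution_coord {𝒟 : (β → ι → ℝ) → (β → ι → ℝ)} {L : (β → ι → ℝ) → (β → ι → ℝ) →L[ℝ] (β → ι → ℝ)}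
    {S : Set (β → ι → ℝ)} (hS : MeasurableSet S) (hconv : Convex ℝ S)
    (h𝒟 : ∀ A ∈ S, HasFDerivWithinAt 𝒟 (L A) S A) {K : ℝ≥0} (hL : ∀ A ∈ S, ‖L A‖₊ ≤ K) (hK : K < 1)
    (g : (β → ι → ℝ) → ℝ≥0∞) :
    ∫⁻ A' in (fun A => A - 𝒟 A) '' S, g A' =
      ∫⁻ A in S, ENNReal.ofReal (1 - jac (L A : (β → ι → ℝ) →ₗ[ℝ] (β → ι → ℝ))).det * g (A - 𝒟 A) := by
  rw [eq18_substitution volume hS hconv h𝒟 hL hK g]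
  refine setLIntegral_congr_fun hS (fun A _ => ?_)
  rw [det_one_sub_eq_det_jac]

/-- **(18) WITH (20) INSERTED**: for `D̃` with the printed support («D̃(A, b, c) = 0 for all b ≠ b₀(c)», (S)) and
locality ((Loc)), differentiable on a convex Borel window `S` with `‖(δ/δA)D̃(A)‖ ≤ K < 1`, the substitution reads
`∫_{(I − D̃)(S)} g(A′) dA′ = ∫_S [Π_{c} det(1 − (∂/∂A(b₀(c)))D̃(A, b₀(c), c))] g(A − D̃(A)) dA`
(`B10Eq20Locality.eq20_det_jac` by name). [cite: Balaban1985UV3, (18) p.260, (20) p.261] -/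
theorem eq18_substitution_eq20 {C : Type*} [Fintype C] [DecidableEq C] {b₀ : C → β} (hb : Function.Injective b₀)
    {𝒟 : (β → ι → ℝ) → (β → ι → ℝ)} (hSupp : IsSupportedOn b₀ 𝒟) (hLoc : IsCoarseLocal b₀ 𝒟)
    {L : (β → ι → ℝ) → (β → ι → ℝ) →L[ℝ] (β → ι → ℝ)} {S : Set (β → ι → ℝ)} (hS : MeasurableSet S)
    (hconv : Convex ℝ S) (h𝒟 : ∀ A ∈ S, HasFDerivAt 𝒟 (L A) A) {K : ℝ≥0} (hL : ∀ A ∈ S, ‖L A‖₊ ≤ K)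
    (hK : K < 1) (g : (β → ι → ℝ) → ℝ≥0∞) :
    ∫⁻ A' in (fun A => A - 𝒟 A) '' S, g A' =
      ∫⁻ A in S, ENNReal.ofReal (∏ c, (1 - coarseBlock b₀ (jac (L A : (β → ι → ℝ) →ₗ[ℝ] (β → ι → ℝ))) c).det)
        * g (A - 𝒟 A) := by
  rw [eq18_substitution volume hS hconv (fun A hA => (h𝒟 A hA).hasFDerivWithinAt) hL hK g]
  refine setLIntegral_congr_fun hS (fun A hA => ?_)
  rw [det_one_sub_eq_det_jac, B10Eq20Locality.eq20_det_jac hb hSupp hLoc (h𝒟 A hA)]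

end Coordinates

/-! ## §3  `G = SU(2)`, finitely many bonds: `∫Π_b dU′(b)` of (13) through `dU′ = σ(A′)dA′` (v1.1 §8 of
`B10Eq18SigmaSU2Haar`) AND the substitution — the integrand shape of (18) -/

section SU2

open B10Eq22Rescaling (sigmaSU2 sigmaSU2_zero)
open B10Eq18SigmaSU2Haar (expPauli sigmaMeasure measurable_expPauli measurable_sigmaSU2_norm
  isProbabilityMeasure_sigmaMeasure lintegral_pi_haarProbability_eq_pauli)
open Literature.MathematicalPhysics.QuantumFieldTheory (haarProbability)

variable {β : Type*} [Fintype β]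

/-- The product chart law `Π_b σ(A(b))dA(b)` (each factor on its ball `|A(b)| < π`) IS Lebesgue measure on the
product window with density `Π_b σ_{SU(2)}(|A(b)|)`. [cite: Balaban1985UV3, (18) p.260] -/
theorem pi_sigmaMeasure_eq :
    Measure.pi (fun _ : β => sigmaMeasure) =
      ((volume : Measure (β → EuclideanSpace ℝ (Fin 3))).restrict
          (Set.pi univ fun _ => ball (0 : EuclideanSpace ℝ (Fin 3)) Real.pi)).withDensity
        fun A => ∏ b, ENNReal.ofReal (sigmaSU2 ‖A b‖) := by
  haveI : ∀ _b : β, IsProbabilityMeasure (((volume : Measure (EuclideanSpace ℝ (Fin 3))).restrict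
      (ball (0 : EuclideanSpace ℝ (Fin 3)) Real.pi)).withDensity fun A => ENNReal.ofReal (sigmaSU2 ‖A‖)) :=
    fun _ => isProbabilityMeasure_sigmaMeasure
  have h := GaussianToolkit.pi_withDensity
    (fun _ : β => (volume : Measure (EuclideanSpace ℝ (Fin 3))).restrict (ball (0 : EuclideanSpace ℝ (Fin 3)) Real.pi))
    (fun _ A => ENNReal.ofReal (sigmaSU2 ‖A‖)) (fun _ => measurable_sigmaSU2_norm.ennreal_ofReal)
  rw [← Measure.restrict_pi_pi, ← volume_pi] at h
  exact h

/-- **`∫ Π_b dU′(b) F(U′) = ∫_{|A(b)|<π ∀b} Π_b σ_{SU(2)}(|A(b)|) · F((exp iA(b))_b) Π_b d³A(b)`** — the many-bond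
`∫dU′↾_{Ω₁}` of (13) as a Lebesgue integral with the product density (measurable `F ≥ 0`).
[cite: Balaban1985UV3, (13) p.259, (18) p.260] -/
theorem lintegral_pi_haarProbability_eq_volume (F : (β → Matrix.specialUnitaryGroup (Fin 2) ℂ) → ℝ≥0∞)
    (hF : Measurable F) :
    ∫⁻ U, F U ∂(Measure.pi fun _ : β => haarProbability (Matrix.specialUnitaryGroup (Fin 2) ℂ)) =
      ∫⁻ A in Set.pi univ (fun _ : β => ball (0 : EuclideanSpace ℝ (Fin 3)) Real.pi),
        (∏ b, ENNReal.ofReal (sigmaSU2 ‖A b‖)) * F (fun b => expPauli (A b)) := by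
  have hmeas : Measurable fun A : β → EuclideanSpace ℝ (Fin 3) => ∏ b, ENNReal.ofReal (sigmaSU2 ‖A b‖) :=
    Finset.measurable_prod _ fun b _ => (measurable_sigmaSU2_norm.comp (measurable_pi_apply b)).ennreal_ofReal
  rw [lintegral_pi_haarProbability_eq_pauli β F hF, pi_sigmaMeasure_eq,
    lintegral_withDensity_eq_lintegral_mul_non_measurable _ hmeas
      (Filter.Eventually.of_forall fun A => ENNReal.prod_lt_top fun b _ => ENNReal.ofReal_lt_top) _]
  rfl

/-- **(13) → (18) FOR `SU(2)`, THE INTEGRAND SHAPE OF (18)**: on a convex Borel window `S` of configurations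
`A : β → ℝ³` with `‖(δ/δA)D̃(A)‖ ≤ K < 1`, for every `F ≥ 0` on `SU(2)^β`,
`∫_{A′ ∈ (I − D̃)(S)} Π_b σ(|A′(b)|) F((e^{iA′(b)})_b) dA′
   = ∫_{A ∈ S} det(I − (δ/δA)D̃(A)) · Π_b σ(|A(b) − D̃(A)(b)|) · F((e^{i(A − D̃(A))(b)})_b) dA`
— `dU′ = σ(A′)dA′` bond by bond, then `A′ = A − D̃(A)`: the factors `det(I − δD̃/δA)`, `σ(A − D̃(A))` and
`exp i(A − D̃(A))` of (18). [cite: Balaban1985UV3, (13) p.259, (18) p.260] -/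
theorem eq18_su2 {𝒟 : (β → EuclideanSpace ℝ (Fin 3)) → (β → EuclideanSpace ℝ (Fin 3))}
    {L : (β → EuclideanSpace ℝ (Fin 3)) → (β → EuclideanSpace ℝ (Fin 3)) →L[ℝ] (β → EuclideanSpace ℝ (Fin 3))}
    {S : Set (β → EuclideanSpace ℝ (Fin 3))} (hS : MeasurableSet S) (hconv : Convex ℝ S)
    (h𝒟 : ∀ A ∈ S, HasFDerivWithinAt 𝒟 (L A) S A) {K : ℝ≥0} (hL : ∀ A ∈ S, ‖L A‖₊ ≤ K) (hK : K < 1)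
    (F : (β → Matrix.specialUnitaryGroup (Fin 2) ℂ) → ℝ≥0∞) :
    ∫⁻ A' in (fun A => A - 𝒟 A) '' S, (∏ b, ENNReal.ofReal (sigmaSU2 ‖A' b‖)) * F (fun b => expPauli (A' b)) =
      ∫⁻ A in S, ENNReal.ofReal ((1 : _ →L[ℝ] _) - L A).det *
        ((∏ b, ENNReal.ofReal (sigmaSU2 ‖(A - 𝒟 A) b‖)) * F (fun b => expPauli ((A - 𝒟 A) b))) :=
  eq18_substitution volume hS hconv h𝒟 hL hK _

/-- The same with print's inequality sign for a smaller `A′`-window `T ⊆ (I − D̃)(S)` (the cut-off `χ′` of (13) inside the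
image of the window `χ` of (18)). [cite: Balaban1985UV3, (13) p.259, (18) p.260] -/
theorem eq18_su2_le {𝒟 : (β → EuclideanSpace ℝ (Fin 3)) → (β → EuclideanSpace ℝ (Fin 3))}
    {L : (β → EuclideanSpace ℝ (Fin 3)) → (β → EuclideanSpace ℝ (Fin 3)) →L[ℝ] (β → EuclideanSpace ℝ (Fin 3))}
    {S : Set (β → EuclideanSpace ℝ (Fin 3))} (hS : MeasurableSet S) (hconv : Convex ℝ S)
    (h𝒟 : ∀ A ∈ S, HasFDerivWithinAt 𝒟 (L A) S A) {K : ℝ≥0} (hL : ∀ A ∈ S, ‖L A‖₊ ≤ K) (hK : K < 1)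
    {T : Set (β → EuclideanSpace ℝ (Fin 3))} (hT : T ⊆ (fun A => A - 𝒟 A) '' S)
    (F : (β → Matrix.specialUnitaryGroup (Fin 2) ℂ) → ℝ≥0∞) :
    ∫⁻ A' in T, (∏ b, ENNReal.ofReal (sigmaSU2 ‖A' b‖)) * F (fun b => expPauli (A' b)) ≤
      ∫⁻ A in S, ENNReal.ofReal ((1 : _ →L[ℝ] _) - L A).det *
        ((∏ b, ENNReal.ofReal (sigmaSU2 ‖(A - 𝒟 A) b‖)) * F (fun b => expPauli ((A - 𝒟 A) b))) :=
  eq18_substitution_le volume hS hconv h𝒟 hL hK hT _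

/-- `σ₀ = σ(0) = 1/2π² > 0`. [cite: Balaban1985UV3, p.260] -/
theorem sigmaSU2_zero_pos : 0 < sigmaSU2 0 := by
  rw [sigmaSU2_zero]
  positivity

/-- **THE `σ₀`-BOOKKEEPING OF (18)**, product part: `Π_b σ(|B(b)|) = σ₀^{#bonds} · Π_b (σ/σ₀)(|B(b)|)` — «dU′ = σ(A′)dA′
= σ₀ (σ/σ₀)(A′)dA′» bond by bond; the factor `σ₀^{#bonds of Ω₁}` is the `+ log σ₀·(number of bonds belonging to Ω₁)`
part of `log σ₀|Ω₁*|` in the exponent of (18) (the two subtractions in `|Ω₁*|` come from the δ-functions, (16):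
`B10Eq18SigmaSU2Haar.dirac_eq_inv_sigma0_smul`, one `σ₀⁻¹` per averaged bond and per axial bond).
[cite: Balaban1985UV3, (18) p.260] -/
theorem prod_sigmaSU2_eq_pow_mul_prod_ratio (B : β → EuclideanSpace ℝ (Fin 3)) :
    ∏ b, sigmaSU2 ‖B b‖ = sigmaSU2 0 ^ Fintype.card β * ∏ b, sigmaSU2 ‖B b‖ / sigmaSU2 0 := by
  rw [← Finset.card_univ, ← Finset.prod_const, ← Finset.prod_mul_distrib]
  refine Finset.prod_congr rfl fun b _ => ?_
  rw [mul_div_cancel₀ _ sigmaSU2_zero_pos.ne']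

/-- `σ₀^n = exp(n · log σ₀)`: the power of `σ₀` as the printed exponential term `+ log σ₀ · n`. [cite: Balaban1985UV3, (18) p.260] -/
theorem sigmaSU2_zero_pow_eq_exp (n : ℕ) : sigmaSU2 0 ^ n = Real.exp (Real.log (sigmaSU2 0) * n) := by
  rw [mul_comm, Real.exp_nat_mul, Real.exp_log sigmaSU2_zero_pos]

/-- **`|Ω₁*|` = (bonds of Ω₁) − (bonds of Ω₁⁽¹⁾) − (axial bonds)**: the three powers of `σ₀` combine into the single
printed term `exp[log σ₀ · |Ω₁*|]`, `|Ω₁*| = n₁ − n₂ − n₃` (an integer, possibly read with signs).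
[cite: Balaban1985UV3, (18) p.260] -/
theorem sigmaSU2_zero_pow_starCount (n₁ n₂ n₃ : ℕ) :
    sigmaSU2 0 ^ n₁ * (sigmaSU2 0 ^ n₂)⁻¹ * (sigmaSU2 0 ^ n₃)⁻¹ =
      Real.exp (Real.log (sigmaSU2 0) * ((n₁ : ℝ) - n₂ - n₃)) := by
  rw [mul_sub, mul_sub, Real.exp_sub, Real.exp_sub, ← sigmaSU2_zero_pow_eq_exp, ← sigmaSU2_zero_pow_eq_exp,
    ← sigmaSU2_zero_pow_eq_exp, div_eq_mul_inv, div_eq_mul_inv]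

end SU2

/-! ## §4  From (17) (`B10Eq17LocalSolution.Eq17Local`: `D̃` analytic near `0`, `D̃(0) = 0`, `(δ/δA)D̃(0) = 0`): a window
`|A| < r′` on which the substitution theorem applies to print's `D̃(A, b, c)` = the cell's `hD̃(A)` -/

section FromEq17

open B13PkLocalTerms (hOp)
open B10Eq17LocalSolution (Eq17Local hOpLin norm_hOpLin_le)
open B10Eq17LocalTorus (hasFDerivAt_hOp_Dt)

variable {β C X : Type*} [Fintype β] [Fintype C] [NormedAddCommGroup X] [NormedSpace ℝ X] [CompleteSpace X]
  {b₀ : C → β} {h : C → X →ₗ[ℝ] X} {Ct : (β → X) → C → X} {r δ : ℝ} {Dt : (β → X) → C → X}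

/-- **THE SMALL-FIELD WINDOW OF THE SUBSTITUTION.**  If `D̃` solves (17) locally (`Eq17Local`: analytic on `|A| < r`,
`D̃(0) = 0`, `(δ/δA)D̃(0) = 0`) and the support operator `h` is bounded (`‖h_c x‖ ≤ b‖x‖`), then there is
`0 < r′ ≤ r` such that on the ball `|A| < r′` the map `A ↦ hD̃(A)` (print's `D̃(A, b, c)`, living on the bonds
`b₀(c)`) is differentiable with `‖(δ/δA)hD̃(A)‖ ≤ 1/2` — «A sufficiently small», by continuity at `0` of the
derivative of an analytic map whose derivative vanishes at `0`. [cite: Balaban1985UV3, (17)-(18) p.260] -/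
theorem exists_window_nnnorm_fderiv_le (h17 : Eq17Local ℝ b₀ (fun c => ⇑(h c)) Ct r δ Dt) {b : ℝ} (hb : 0 ≤ b)
    (hh : ∀ c x, ‖h c x‖ ≤ b * ‖x‖) :
    ∃ r', 0 < r' ∧ r' ≤ r ∧ ∀ A : β → X, ‖A‖ < r' →
      HasFDerivAt (fun A => hOp b₀ (fun c => ⇑(h c)) (Dt A))
          (fderiv ℝ (fun A => hOp b₀ (fun c => ⇑(h c)) (Dt A)) A) A ∧
        ‖fderiv ℝ (fun A => hOp b₀ (fun c => ⇑(h c)) (Dt A)) A‖₊ ≤ (1 / 2 : ℝ≥0) := by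
  have hr : 0 < r := h17.1
  have han : AnalyticOn ℝ Dt (ball 0 r) := h17.2.2.2.1
  have hD0 : HasFDerivAt Dt (0 : (β → X) →L[ℝ] (C → X)) 0 := h17.2.2.2.2.2
  set hL : (C → X) →L[ℝ] (β → X) := (hOpLin b₀ h).mkContinuous b (norm_hOpLin_le b₀ h hb hh) with hLdef
  have hDt0 : fderiv ℝ Dt 0 = 0 := hD0.fderiv
  have hanAt : AnalyticAt ℝ Dt 0 :=
    (isOpen_ball.analyticOn_iff_analyticOnNhd.1 han) 0 (mem_ball_self hr)
  have hcont : ContinuousAt (fderiv ℝ Dt) 0 :=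
    ((hanAt.contDiffAt (n := ω)).fderiv_right (m := 0) le_top).continuousAt
  set ε : ℝ := 1 / (2 * (‖hL‖ + 1)) with hεdef
  have hε : 0 < ε := by positivity
  obtain ⟨ρ, hρ, hball⟩ := Metric.continuousAt_iff.1 hcont ε hε
  have key : ‖hL‖ * ε ≤ 1 / 2 := by
    rw [hεdef, mul_one_div, div_le_iff₀ (by positivity : (0 : ℝ) < 2 * (‖hL‖ + 1))]
    nlinarith [norm_nonneg hL]
  refine ⟨min r ρ, lt_min hr hρ, min_le_left _ _, fun A hA => ?_⟩
  have hAr : ‖A‖ < r := lt_of_lt_of_le hA (min_le_left _ _)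
  have hAρ : dist A 0 < ρ := by
    rw [dist_zero_right]
    exact lt_of_lt_of_le hA (min_le_right _ _)
  have hderiv : HasFDerivAt (fun A => hOp b₀ (fun c => ⇑(h c)) (Dt A)) (hL.comp (fderiv ℝ Dt A)) A :=
    hasFDerivAt_hOp_Dt h17 hb hh hAr
  refine ⟨hderiv.differentiableAt.hasFDerivAt, ?_⟩
  rw [hderiv.fderiv]
  have h1 : ‖fderiv ℝ Dt A‖ < ε := by
    have h' := hball hAρ
    rwa [hDt0, dist_zero_right] at h'
  have h2 : ‖hL.comp (fderiv ℝ Dt A)‖ ≤ 1 / 2 :=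
    calc ‖hL.comp (fderiv ℝ Dt A)‖ ≤ ‖hL‖ * ‖fderiv ℝ Dt A‖ := ContinuousLinearMap.opNorm_comp_le _ _
      _ ≤ ‖hL‖ * ε := by gcongr
      _ ≤ 1 / 2 := key
  rw [← NNReal.coe_le_coe, coe_nnnorm]
  push_cast
  exact h2

/-- **(18) FOR THE SOLUTION OF (17).**  With `D̃ = hD̃` as above, `X` finite-dimensional (print: `X = 𝔤`) and any
Lebesgue (additive Haar) measure `dA` on the configurations `A : β → X`: there is a window `0 < r′ ≤ r` such that on
every convex Borel `S ⊆ {|A| < r′}` the substitution `A′ = A − D̃(A)` is injective, its Jacobian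
`det(I − (δ/δA)D̃(A))` is positive, and
`∫_{(I − D̃)(S)} g(A′) dA′ = ∫_S det(I − (δ/δA)D̃(A)) g(A − D̃(A)) dA` for every `g ≥ 0`.
[cite: Balaban1985UV3, (17)-(18) p.260] -/
theorem eq18_substitution_of_eq17Local [FiniteDimensional ℝ X] [MeasurableSpace X] [BorelSpace X]
    (μ : Measure (β → X)) [IsAddHaarMeasure μ]
    (h17 : Eq17Local ℝ b₀ (fun c => ⇑(h c)) Ct r δ Dt) {b : ℝ} (hb : 0 ≤ b) (hh : ∀ c x, ‖h c x‖ ≤ b * ‖x‖) :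
    ∃ r', 0 < r' ∧ r' ≤ r ∧ ∀ S : Set (β → X), MeasurableSet S → Convex ℝ S → S ⊆ ball 0 r' →
      InjOn (fun A => A - hOp b₀ (fun c => ⇑(h c)) (Dt A)) S ∧
      (∀ A ∈ S, 0 < ((1 : (β → X) →L[ℝ] (β → X)) -
          fderiv ℝ (fun A => hOp b₀ (fun c => ⇑(h c)) (Dt A)) A).det) ∧
      ∀ g : (β → X) → ℝ≥0∞,
        ∫⁻ A' in (fun A => A - hOp b₀ (fun c => ⇑(h c)) (Dt A)) '' S, g A' ∂μ =
          ∫⁻ A in S, ENNReal.ofReal ((1 : (β → X) →L[ℝ] (β → X)) -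
              fderiv ℝ (fun A => hOp b₀ (fun c => ⇑(h c)) (Dt A)) A).det *
            g (A - hOp b₀ (fun c => ⇑(h c)) (Dt A)) ∂μ := by
  obtain ⟨r', hr', hr'r, hwin⟩ := exists_window_nnnorm_fderiv_le h17 hb hh
  refine ⟨r', hr', hr'r, fun S hS hconv hSr => ?_⟩
  have hD : ∀ A ∈ S, HasFDerivWithinAt (fun A => hOp b₀ (fun c => ⇑(h c)) (Dt A))
      (fderiv ℝ (fun A => hOp b₀ (fun c => ⇑(h c)) (Dt A)) A) S A :=
    fun A hA => (hwin A (mem_ball_zero_iff.1 (hSr hA))).1.hasFDerivWithinAt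
  have hK : ∀ A ∈ S, ‖fderiv ℝ (fun A => hOp b₀ (fun c => ⇑(h c)) (Dt A)) A‖₊ ≤ (1 / 2 : ℝ≥0) :=
    fun A hA => (hwin A (mem_ball_zero_iff.1 (hSr hA))).2
  have hhalf : (1 / 2 : ℝ≥0) < 1 := by
    rw [← NNReal.coe_lt_coe]
    push_cast
    norm_num
  exact ⟨injOn_id_sub_of_nnnorm_fderiv_le hconv hD hK hhalf,
    fun A hA => det_one_sub_pos (norm_lt_one_of_nnnorm_le (hK A hA) hhalf),
    fun g => eq18_substitution μ hS hconv hD hK hhalf g⟩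

end FromEq17

end Literature.MathematicalPhysics.QuantumFieldTheory.Balaban1983to89.B10Eq18ChangeOfVariables

end
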